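import Literature.AlgebraicGeometry.Motives.PoincareUniversal.GraphCondition
import Literature.AlgebraicGeometry.Motives.DualNumberPoints
import HarnessLib

/-!
# Translation of the graph condition of a `ℂ[ε]`-valued test point to the Mumford family:
# `(1 × w)^*Λ(𝒪(Θ)) ≅ pr₁^*(ℒ|_{A × {t}})` on `A × Spec ℂ[ε]` (Mumford, *Abelian Varieties* §13, proof of the Theorem)

Layer `Literature/AlgebraicGeometry/Motives/PoincareUniversal`, namespace `Literature.AlgebraicGeometry.Motives.AbelianVariety`.
THEOREMS ONLY (no definition, no named fact, no instance).  Setting of `Motives/PoincareUniversal/GraphCondition` (Mumford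
§13 p. 125: «`Γ(S) = {g : S → X̂ ; (1 × g)^*P ≅ L_S}`», the tree's `GraphCond A₀ hΘ P T' ℒ u` for a test morphism
`u = (u₁, u₂) : S → T × Â` over `ℂ`, with `restrictAlong A₀ hΘ T' u = 1_{A₀} × u₁`) and of the dual numbers
`dualNumberOver = Spec ℂ[ε]` (`Motives/DualNumberPoints`; Görtz–Wedhorn I (6.3)–(6.4)).

For a test morphism out of `S = Spec ℂ[ε]` with CONSTANT first coordinate `u₁ = t ∘ str` (`t` a `ℂ`-point of `T`) and
second coordinate `u₂ = φ_Θ ∘ w` lifted along the isogeny `φ_Θ : A₀ → Â = A₀/K(Θ)` (Mumford §8 / Milne I §8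
«`(1 × λ_L)^*𝒫 = L^*`», the tree's `nonempty_pullback_oneProdPhiTheta_poincareSheaf_iso` furnishing the hypothesis
`eP : (1 × φ_Θ)^*P ≅ Λ(𝒪(Θ))`), the graph condition becomes a statement about the MUMFORD FAMILY restricted along `w`:

* `restrictAlong_eq_fst_comp_slice` — for constant first coordinate, `1 × u₁ = pr₁ ≫ (slice at t)` on `A₀ ×_ℂ S`
  (Milne I §8 pp. 36–37: restriction of a family to a fibre);
* `whiskerLeft_phiTheta_left_eq` — `(A₀ ◁ φ_Θ).left` is the scheme morphism of `1 × φ_Θ` (`oneProdPhiTheta_hom`);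
* **`translateToMumford_of_graphCond`** — the graph condition for `(t ∘ str, φ_Θ ∘ w)` yields a rank-one `N` on `A₀`
  (namely `ℒ|_{A₀ × {t}}`) with `(1 × w)^*Λ(𝒪(Θ)) ≅ pr₁^*N` on `A₀ × Spec ℂ[ε]`: the first-order deformation of
  `t_{x₀}^*𝒪(Θ)` along the tangent vector of `w` is CONSTANT — the input of the dual-number rigidity of the seesaw graph
  (Mumford §13 p. 125; composed from ★ `baseChangeToProd_ofAbelianVariety_eq_whiskerLeft_left`, `whiskerLeft_comp` and
  Mathlib `Scheme.Modules.pullbackComp`).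

Cell `hodgecm-mathlib`, programme M13 on the Poincaré bundle (node N3d, row F9 of the phase-B split; B-p19 (g10) text,
B-p03 (g12) custodian).  Presearch: Mumford §13 pp. 125–130 (held djvu); Milne AV I §8; the slice factorisation is
folklore.  HC_CM is proved only modulo the 7 printed citations until rung 0 closes — this file asserts nothing about HC.

## References
* D. Mumford, *Abelian Varieties* (1970), §8, §13 proof of the Theorem (p. 125). [MumfordAV1970]
* J. S. Milne, *Abelian Varieties* (2008), I §8 (pp. 36–40). [MilneAV2008]
* U. Görtz, T. Wedhorn, *Algebraic Geometry I*, 2nd ed. (2020), (6.3)–(6.4); (4.8)/Prop. 4.16 (fibre products). [GortzWedhorn2020]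
-/

noncomputable section

universe u

open CategoryTheory CategoryTheory.Limits AlgebraicGeometry MonoidalCategory CartesianMonoidalCategory
open scoped DualNumber

namespace Literature.AlgebraicGeometry.Motives.AbelianVariety

open Literature.AlgebraicGeometry.AbelianSchemes Literature.AlgebraicGeometry.AbelianVarieties
  Literature.AlgebraicGeometry.Modules

section R2
variable (A₀ : AbelianVariety ℂ) {Θ : CartierDivisor A₀.X.left} (hΘ : Θ.IsAmple)
  (P : (A₀.X ⊗ (A₀.dualOf Θ hΘ).X).left.Modules)
  (T' : SchemeOver ℂ) (ℒ : (AbelianSchemeOver.ofAbelianVariety A₀).RigidifiedLineBundle T'.hom)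

/-- The second leg of the slice `A₀ → A₀ ×_ℂ T` at a `ℂ`-point `t` of `T` commutes with the structure maps.
[cite: GortzWedhorn2020, Prop. 4.16 (pp. 101–104)] -/
theorem id_comp_hom_eq_toUnit_comp_left_comp_hom (t : 𝟙_ (SchemeOver ℂ) ⟶ T') :
    𝟙 A₀.X.left ≫ A₀.X.hom = (toUnit A₀.X ≫ t).left ≫ T'.hom := by
  rw [Category.id_comp]
  exact (Over.w (toUnit A₀.X ≫ t)).symm

/-- **For a test pair with CONSTANT first coordinate `t`, `restrictAlong` factors through the slice at `t`**:
`restrictAlong (t ∘ str, ·) = pr₁ ≫ (a ↦ (a, t))` on `A₀ ×_ℂ S`. [cite: MilneAV2008, I §8 (pp. 36–37)] -/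
theorem restrictAlong_eq_fst_comp_slice {S : SchemeOver ℂ} (u : S ⟶ T' ⊗ (A₀.dualOf Θ hΘ).X)
    (t : 𝟙_ (SchemeOver ℂ) ⟶ T') (hu : u ≫ CartesianMonoidalCategory.fst _ _ = toUnit _ ≫ t) :
    restrictAlong A₀ hΘ T' u = pullback.fst A₀.X.hom S.hom ≫
      pullback.lift (𝟙 _) ((toUnit A₀.X ≫ t).left) (id_comp_hom_eq_toUnit_comp_left_comp_hom A₀ T' t) := by
  unfold restrictAlong
  apply pullback.hom_ext
  · rw [pullback.lift_fst, Category.assoc, pullback.lift_fst, Category.comp_id]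
  · rw [pullback.lift_snd, Category.assoc, pullback.lift_snd, hu, Over.comp_left, Over.comp_left,
      ← Category.assoc, ← Category.assoc, toUnit_left, toUnit_left]
    exact congrArg (fun k => k ≫ t.left) (pullback.condition (f := A₀.X.hom) (g := S.hom)).symm

/-- `(A₀ ◁ φ_Θ).left` is the underlying scheme morphism of `1 × φ_Θ` (★ `AbelianVarieties.oneProdPhiTheta_hom`).
[cite: MilneAV2008, I §8 (p. 40)] -/
theorem whiskerLeft_phiTheta_left_eq :
    (A₀.X ◁ (A₀.phiTheta Θ hΘ).hom.hom.hom).left = AbelianVariety.Hom.toSchemeHom (A₀.oneProdPhiTheta hΘ) := by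
  have h : ((A₀.oneProdPhiTheta hΘ).hom.hom.hom : A₀.X ⊗ A₀.X ⟶ A₀.X ⊗ (A₀.dualOf Θ hΘ).X) =
      A₀.X ◁ (A₀.phiTheta Θ hΘ).hom.hom.hom := by
    rw [AbelianVarieties.oneProdPhiTheta_hom]
    apply CartesianMonoidalCategory.hom_ext <;> simp
  exact congrArg (fun k : A₀.X ⊗ A₀.X ⟶ A₀.X ⊗ (A₀.dualOf Θ hΘ).X => k.left) h.symm

/-- **Translation of the graph condition to the Mumford family.**  With `(1 × φ_Θ)^*𝒫 ≅ Λ(𝒪(Θ))` (`eP`), the graph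
condition for the `ℂ[ε]`-valued test point `(t ∘ str, φ_Θ ∘ w)` gives a rank-one `N` on `A₀` (namely `ℒ|_{A₀ × {t}}`) with
`(1 × w)^*Λ(𝒪(Θ)) ≅ pr₁^*N` on `A₀ × Spec ℂ[ε]`: the left map of the graph condition is
`(A₀ ◁ (w ≫ φ_Θ)).left = (A₀ ◁ w).left ≫ (1 × φ_Θ)`, the right map factors as `pr₁ ≫ (slice at t)`, and
`Scheme.Modules.pullbackComp` composes. [cite: MumfordAV1970, §13 (proof of the Thm. p. 125)] [cite: MilneAV2008, I §8 (pp. 36–37)] -/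
theorem translateToMumford_of_graphCond [P.IsQuasicoherent] (_hP1 : HasRank P 1)
    (eP : Nonempty ((Scheme.Modules.pullback (AbelianVariety.Hom.toSchemeHom (A₀.oneProdPhiTheta hΘ))).obj P ≅
      mumfordSheaf A₀ Θ))
    (w : dualNumberOver ⟶ A₀.X) (t : 𝟙_ (SchemeOver ℂ) ⟶ T')
    (hc : GraphCond A₀ hΘ P T' ℒ
      (CartesianMonoidalCategory.lift (toUnit _ ≫ t) (w ≫ (A₀.phiTheta Θ hΘ).hom.hom.hom))) :
    ∃ N : A₀.X.left.Modules, HasRank N 1 ∧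
      Nonempty ((Scheme.Modules.pullback (A₀.X ◁ w).left).obj (mumfordSheaf A₀ Θ) ≅
        (Scheme.Modules.pullback (CartesianMonoidalCategory.fst A₀.X dualNumberOver).left).obj N) := by
  obtain ⟨ψ⟩ := hc
  obtain ⟨e⟩ := eP
  set φ := (A₀.phiTheta Θ hΘ).hom.hom.hom with hφ
  set u := CartesianMonoidalCategory.lift (toUnit dualNumberOver ≫ t) (w ≫ φ) with hudef
  -- the left-hand map of the graph condition is `(A₀ ◁ (w ≫ φ_Θ)).left = (A₀ ◁ w).left ≫ (1 × φ_Θ)`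
  have hbc : (AbelianSchemeOver.ofAbelianVariety A₀).baseChangeToProd
      (AbelianSchemeOver.ofAbelianVariety (A₀.dualOf Θ hΘ)) dualNumberOver.hom
      (u ≫ CartesianMonoidalCategory.snd _ _).left
      (Over.w (u ≫ CartesianMonoidalCategory.snd _ _)) =
      (A₀.X ◁ w).left ≫ (A₀.X ◁ φ).left := by
    rw [AbelianSchemeOver.baseChangeToProd_ofAbelianVariety_eq_whiskerLeft_left A₀ (A₀.dualOf Θ hΘ)
      (u ≫ CartesianMonoidalCategory.snd _ _), hudef, CartesianMonoidalCategory.lift_snd,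
      MonoidalCategory.whiskerLeft_comp, Over.comp_left]
  -- the right-hand map factors through the slice at `t`
  set slice : A₀.X.left ⟶ pullback A₀.X.hom T'.hom :=
    pullback.lift (𝟙 _) ((toUnit A₀.X ≫ t).left) (id_comp_hom_eq_toUnit_comp_left_comp_hom A₀ T' t) with hslice
  have hres : restrictAlong A₀ hΘ T' u = pullback.fst A₀.X.hom dualNumberOver.hom ≫ slice :=
    restrictAlong_eq_fst_comp_slice A₀ hΘ T' u t (by rw [hudef, CartesianMonoidalCategory.lift_fst])
  refine ⟨(Scheme.Modules.pullback slice).obj ℒ.L, Modules.hasRank_pullback _ ℒ.hasRank_one, ⟨?_⟩⟩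
  have eφ : (Scheme.Modules.pullback (A₀.X ◁ φ).left).obj P ≅ mumfordSheaf A₀ Θ :=
    eqToIso (congrArg (fun k : (A₀.X ⊗ A₀.X).left ⟶ (A₀.X ⊗ (A₀.dualOf Θ hΘ).X).left =>
      (Scheme.Modules.pullback k).obj P) (whiskerLeft_phiTheta_left_eq A₀ hΘ)) ≪≫ e
  exact ((Scheme.Modules.pullback (A₀.X ◁ w).left).mapIso eφ).symm ≪≫
    ((Scheme.Modules.pullbackComp (A₀.X ◁ w).left (A₀.X ◁ φ).left).app P) ≪≫
    eqToIso (congrArg (fun k => (Scheme.Modules.pullback k).obj P) hbc).symm ≪≫ ψ ≪≫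
    eqToIso (congrArg (fun k => (Scheme.Modules.pullback k).obj ℒ.L) hres) ≪≫
    ((Scheme.Modules.pullbackComp (pullback.fst A₀.X.hom dualNumberOver.hom) slice).app ℒ.L).symm

end R2

end Literature.AlgebraicGeometry.Motives.AbelianVariety

end
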